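import Mathlib
import HarnessLib
import Summits.Ventures.LatticeQCDFlow.Exactness.SphereLuscherSeriesConstants
import Summits.Ventures.LatticeQCDFlow.Exactness.SphereLuscherSeriesExtensive

/-!
# Every constant of Lüscher's recursion for the lattice CP(N−1)/O(N) action is at most linear in the volume: `ċ_{k+1}² ≤ 4(d−1)²·Var_π̄(S̃⁽ᵏ⁾)·Var_π̄(S)`, `Var_π̄(S) ≤ |Λ|(Δ+1)²(κυ)²`

HONEST FRAMING: exact (Metropolis-corrected) sampling algorithms for lattice gauge theory;
figures of merit are autocorrelation/cost numbers at stated couplings and volumes; no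
continuum-physics claim.

Venture `LatticeQCDFlow` (cell pub-lqcd), topic `Exactness`; FANOUT row 7 (`s0-cpn-null`).  NEW WORK
of the cell over the tree's `Exactness/SphereLuscherSeriesConstants.lean` (this leg:
`ċ_{k+1} = 2(d−1)·∫S̃⁽ᵏ⁾(S − S₀)dπ̄` for every `C²` Lüscher series of the E–S action, `∫S dπ̄ = S₀`,
Cauchy–Schwarz on `Ω`), `Exactness/SphereLuscherSeriesExtensive.lean` (this leg:
`Var_π̄(S̃⁽ᵏ⁾) ≤ |Λ|·(Δ+1)^{2(k+1)}·(κυ)^{2(k+1)}·A_k` for every `C²` series),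
`Exactness/LatticeLocalSumVariance.lean` (this leg: `Var(Σ_nF_n) ≤ |Λ|·(Δ+1)^{2r}·b` for local
functionals of a product measure), `Exactness/SphereLuscherLocalTermBounds.lean` (`norm_localField_le`)
and `Exactness/SphereLuscherSeriesLocalityES.lean` (GEN-9: `esPart`, `esPart_mem`, `sum_esPart`);
nothing is cited as a fact.  Printed counterpart, NAMED ONLY: M. Lüscher, Commun. Math. Phys. 293
(2010) 899, §3.2–§3.3 (the constants `Ċ_t` of the recursion are the `t`-derivative of the
log-normalisation of the flowed measure — an extensive quantity); Engel–Schaefer, Comput. Phys.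
Commun. 182 (2011) 2107, §3.  Here, inside the recursion and with no reference to `t > 0`: the
action itself has extensive fluctuations under `π̄`, and therefore (Cauchy–Schwarz on the covariance
form of the constants) EVERY constant `ċ_{k+1}` of EVERY `C²` Lüscher series of the lattice
CP(N−1)/O(N) action is at most linear in the volume, with a coefficient depending on the order,
`d = dim E`, the coordination number and the coupling only.

## Setting

`d = dim E ≥ 2`, `Λ` finite nonempty, `π̄ = ⊗_Λ σ̄` the uniform product probability measure on
`Ω = S(E)^Λ`; E–S couplings `U` (no self-coupling, adjoint pairs), weight `Σ_m‖U_{km}‖ ≤ υ`, at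
most `Δ` partners per site; `S = esAction κ S₀ U = Σ_n s_n`, `s_n = esPart κ S₀ U n`; `(St k, c k)` a
`C²` Lüscher series of `S`; `A_k = localVarConst d Δ k`.

## Content

* `variance_esPart_le` — `Var_π̄(s_n) ≤ (κυ)²` (each part fluctuates by at most `|κ|υ` on `Ω`).
* **`variance_esAction_le`** — `Var_π̄(S) = ∫(S − S₀)²dπ̄ ≤ |Λ|·(Δ+1)²·(κυ)²`: THE ACTION IS
  EXTENSIVE (parts supported in radius-`1` coupling balls + `LatticeLocalSumVariance`).
* **`sq_luscher_constant_succ_le`** — for every `C²` Lüscher series and every `k`: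
  `c_{k+1}² ≤ 4(d−1)²·(|Λ|(Δ+1)^{2(k+1)}(κυ)^{2(k+1)}A_k)·(|Λ|(Δ+1)²(κυ)²)`, i.e.
  `|c_{k+1}| ≤ 2(d−1)(Δ+1)^{k+2}(κυ)^{k+2}√A_k · |Λ|` — EVERY CONSTANT IS `O(|Λ|)`.

NOT CLAIMED: lower bounds; the cumulant reading of `ċ_k` beyond `k ≤ 1`; closed forms for `k ≥ 2`;
anything at `t > 0`, about autocorrelations or the rung's numbers.
-/

noncomputable section

namespace Summit.Ventures.LatticeQCDFlow.Exactness

open Function Set Metric MeasureTheory NormedSpace InnerProductSpace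
open scoped RealInnerProductSpace

variable {Λ : Type*} {E : Type*} [NormedAddCommGroup E] [InnerProductSpace ℝ E]
  [FiniteDimensional ℝ E] [MeasurableSpace E] [BorelSpace E]

/-! ## The action is extensive; every constant of the recursion is at most linear in the volume -/

section Extensive

variable [Fintype Λ] [DecidableEq Λ] [Nonempty Λ] [Nontrivial E] {U : Λ → Λ → (E →L[ℝ] E)}

omit [DecidableEq Λ] [Nonempty Λ] in
/-- **`Var(s_n) ≤ (κυ)²`**: each part `s_n = −κ⟪x_n, J_n⟫ + S₀/|Λ|` of the action fluctuates by at
most `|κ|υ` on `Ω`. -/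
theorem variance_esPart_le (κ S₀ : ℝ) {υ : ℝ} (hυ : ∀ k, ∑ m, ‖U k m‖ ≤ υ) (n : Λ) :
    ∫ ω, (esPart κ S₀ U n (fun m => ((ω : Λ → sphere (0 : E) 1) m : E)) -
        ∫ ω', esPart κ S₀ U n (fun m => ((ω' : Λ → sphere (0 : E) 1) m : E))
          ∂Measure.pi (fun _ : Λ => uniformSphere (volume : Measure E))) ^ 2
        ∂Measure.pi (fun _ : Λ => uniformSphere (volume : Measure E)) ≤ (κ * υ) ^ 2 := by
  set μ : Measure (sphere (0 : E) 1) := uniformSphere (volume : Measure E) with hμ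
  have hpc : Continuous fun ω : Λ → sphere (0 : E) 1 => esPart κ S₀ U n (fun m => (ω m : E)) :=
    (contDiff_of_mem_polyS (esPart_mem κ S₀ U n).1).continuous.comp continuous_sphereConfig
  have hpart : ∀ ω : Λ → sphere (0 : E) 1,
      (esPart κ S₀ U n (fun m => (ω m : E)) - S₀ / Fintype.card Λ) ^ 2 ≤ (κ * υ) ^ 2 := fun ω => by
    have hx : ∀ m, ‖((ω m : sphere (0 : E) 1) : E)‖ = 1 := fun m => by simp
    have hin : |⟪((ω n : sphere (0 : E) 1) : E), localField U n (fun m => (ω m : E))⟫| ≤ υ :=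
      (abs_real_inner_le_norm _ _).trans (by
        rw [hx n, one_mul]; exact norm_localField_le hυ hx n)
    have e : esPart κ S₀ U n (fun m => (ω m : E)) - S₀ / Fintype.card Λ =
        -κ * ⟪((ω n : sphere (0 : E) 1) : E), localField U n (fun m => (ω m : E))⟫ := by
      simp only [esPart]; ring
    rw [e]
    calc (-κ * ⟪((ω n : sphere (0 : E) 1) : E), localField U n (fun m => (ω m : E))⟫) ^ 2
        = κ ^ 2 * |⟪((ω n : sphere (0 : E) 1) : E), localField U n (fun m => (ω m : E))⟫| ^ 2 := by
          rw [mul_pow, neg_sq, sq_abs]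
      _ ≤ κ ^ 2 * υ ^ 2 := by gcongr
      _ = (κ * υ) ^ 2 := by ring
  calc _ ≤ ∫ ω, (esPart κ S₀ U n (fun m => ((ω : Λ → sphere (0 : E) 1) m : E)) -
        S₀ / Fintype.card Λ) ^ 2
          ∂Measure.pi (fun _ : Λ => μ) := variance_le_integral_sub_const_sq hpc _
    _ ≤ ∫ _, (κ * υ) ^ 2 ∂Measure.pi (fun _ : Λ => μ) :=
        integral_mono (integrable_pi_of_continuous μ ((hpc.sub continuous_const).pow 2))
          (integrable_const _) hpart
    _ = (κ * υ) ^ 2 := by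
        rw [integral_const, smul_eq_mul, Measure.real, measure_univ, ENNReal.toReal_one, one_mul]

/-- **THE ACTION IS EXTENSIVE**: `Var_π̄(S) = ∫(S − S₀)² dπ̄ ≤ |Λ|·(Δ+1)²·(κυ)²` (the parts `s_n` are
supported in the radius-`1` coupling balls; `LatticeLocalSumVariance`). -/
theorem variance_esAction_le (h2 : 2 ≤ Module.finrank ℝ E) (hU0 : ∀ n, U n n = 0)
    (hUadj : ∀ m n (v w : E), ⟪U m n v, w⟫ = ⟪v, U n m w⟫) (κ S₀ : ℝ) {υ : ℝ}
    (hυ : ∀ k, ∑ m, ‖U k m‖ ≤ υ) {Δ : ℕ} (hΔ : ∀ m, (couplingNbhd U m).ncard ≤ Δ) :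
    ∫ ω, (esAction κ S₀ U (fun m => ((ω : Λ → sphere (0 : E) 1) m : E)) - S₀) ^ 2
      ∂Measure.pi (fun _ : Λ => uniformSphere (volume : Measure E)) ≤
      Fintype.card Λ * ((((Δ + 1) ^ 1 * (Δ + 1) ^ 1 : ℕ)) : ℝ) * (κ * υ) ^ 2 := by
  have hFc : ∀ n, Continuous fun ω : Λ → sphere (0 : E) 1 =>
      esPart κ S₀ U n (fun m => (ω m : E)) := fun n =>
    (contDiff_of_mem_polyS (esPart_mem κ S₀ U n).1).continuous.comp continuous_sphereConfig
  have h := variance_sum_le_of_local (uniformSphere (volume : Measure E))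
    (couplingNbhd_symm hUadj) hΔ 1 hFc
    (fun n => dependsOn_sphereConfig (esPart_mem κ S₀ U n).2)
    (fun n => variance_esPart_le (Λ := Λ) κ S₀ hυ n)
  have hsum : ∀ ω : Λ → sphere (0 : E) 1, ∑ n, esPart κ S₀ U n (fun m => (ω m : E)) =
      esAction κ S₀ U (fun m => (ω m : E)) := fun ω => congrFun (sum_esPart κ S₀ U) _
  simp_rw [hsum, integral_esAction_uniform hU0 hUadj h2 κ S₀] at h
  exact h

/-- **EVERY CONSTANT OF LÜSCHER'S RECURSION IS AT MOST LINEAR IN THE VOLUME.**  For every `C²`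
Lüscher series of the E–S action (weight `≤ υ`, at most `Δ` partners per site, `d = dim E ≥ 2`):
`c_{k+1}² ≤ 4(d−1)² · (|Λ|·(Δ+1)^{2(k+1)}·(κυ)^{2(k+1)}·A_k(d,Δ)) · (|Λ|·(Δ+1)²·(κυ)²)`, i.e.
`|c_{k+1}| ≤ 2(d−1)(Δ+1)^{k+2}(κυ)^{k+2}√A_k · |Λ|` (Cauchy–Schwarz on `2(d−1)·Cov(St_k, S)`). -/
theorem sq_luscher_constant_succ_le (h2 : 2 ≤ Module.finrank ℝ E) (hU0 : ∀ n, U n n = 0)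
    (hUadj : ∀ m n (v w : E), ⟪U m n v, w⟫ = ⟪v, U n m w⟫) (κ S₀ : ℝ) {υ : ℝ}
    (hυ : ∀ k, ∑ m, ‖U k m‖ ≤ υ) {Δ : ℕ} (hΔ : ∀ m, (couplingNbhd U m).ncard ≤ Δ)
    {St : ℕ → (Λ → E) → ℝ} {c : ℕ → ℝ} (hSt : ∀ k, ContDiff ℝ 2 (St k))
    (h0 : ∀ ξ : Λ → sphere (0 : E) 1,
      -∑ n, siteLaplacian n (St 0) (fun m => (ξ m : E)) =
        esAction κ S₀ U (fun m => (ξ m : E)) + c 0)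
    (hs : ∀ k, ∀ ξ : Λ → sphere (0 : E) 1,
      -∑ n, siteLaplacian n (St (k + 1)) (fun m => (ξ m : E)) =
        -(∑ n, ⟪siteGrad n (esAction κ S₀ U) (fun m => (ξ m : E)),
            siteGrad n (St k) (fun m => (ξ m : E))⟫) + c (k + 1)) (k : ℕ) :
    c (k + 1) ^ 2 ≤ 4 * ((Module.finrank ℝ E : ℝ) - 1) ^ 2 *
      (Fintype.card Λ * ((((Δ + 1) ^ (k + 1) * (Δ + 1) ^ (k + 1) : ℕ)) : ℝ) *
        ((κ * υ) ^ (2 * (k + 1)) * localVarConst (Module.finrank ℝ E) Δ k)) *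
      (Fintype.card Λ * ((((Δ + 1) ^ 1 * (Δ + 1) ^ 1 : ℕ)) : ℝ) * (κ * υ) ^ 2) := by
  have hSc : Continuous fun ω : Λ → sphere (0 : E) 1 => esAction κ S₀ U (fun m => (ω m : E)) :=
    (contDiff_esAction U κ S₀ (m := 0)).continuous.comp continuous_sphereConfig
  have hStc : Continuous fun ω : Λ → sphere (0 : E) 1 => St k (fun m => (ω m : E)) :=
    (hSt k).continuous.comp continuous_sphereConfig
  -- centre `St k`: `∫ St_k (S − S₀) = ∫ (St_k − m_k)(S − S₀)` since `∫(S − S₀) = 0`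
  have hmean : ∫ ω, (esAction κ S₀ U (fun m => ((ω : Λ → sphere (0 : E) 1) m : E)) - S₀)
      ∂Measure.pi (fun _ : Λ => uniformSphere (volume : Measure E)) = 0 := by
    rw [integral_sub (integrable_pi_of_continuous _ hSc) (integrable_const _),
      integral_esAction_uniform hU0 hUadj h2 κ S₀, integral_const, smul_eq_mul, Measure.real,
      measure_univ, ENNReal.toReal_one, one_mul, sub_self]
  have hc1 : Continuous fun ω : Λ → sphere (0 : E) 1 => St k (fun m => (ω m : E)) -
      ∫ ω', St k (fun m => ((ω' : Λ → sphere (0 : E) 1) m : E))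
        ∂Measure.pi (fun _ : Λ => uniformSphere (volume : Measure E)) := hStc.sub continuous_const
  have hc2 : Continuous fun ω : Λ → sphere (0 : E) 1 =>
      esAction κ S₀ U (fun m => (ω m : E)) - S₀ := hSc.sub continuous_const
  have hiP : Integrable (fun ω : Λ → sphere (0 : E) 1 => (St k (fun m => (ω m : E)) -
      ∫ ω', St k (fun m => ((ω' : Λ → sphere (0 : E) 1) m : E))
        ∂Measure.pi (fun _ : Λ => uniformSphere (volume : Measure E))) *
      (esAction κ S₀ U (fun m => (ω m : E)) - S₀))
        (Measure.pi fun _ : Λ => uniformSphere (volume : Measure E)) :=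
    integrable_pi_of_continuous _ (hc1.mul hc2)
  have hiS : Integrable (fun ω : Λ → sphere (0 : E) 1 =>
      (∫ ω', St k (fun m => ((ω' : Λ → sphere (0 : E) 1) m : E))
        ∂Measure.pi (fun _ : Λ => uniformSphere (volume : Measure E))) *
      (esAction κ S₀ U (fun m => (ω m : E)) - S₀))
        (Measure.pi fun _ : Λ => uniformSphere (volume : Measure E)) :=
    (integrable_pi_of_continuous _ hc2).const_mul _
  have hcentre : ∫ ω, St k (fun m => ((ω : Λ → sphere (0 : E) 1) m : E)) *
      (esAction κ S₀ U (fun m => (ω m : E)) - S₀)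
        ∂Measure.pi (fun _ : Λ => uniformSphere (volume : Measure E)) =
      ∫ ω, (St k (fun m => ((ω : Λ → sphere (0 : E) 1) m : E)) -
        ∫ ω', St k (fun m => ((ω' : Λ → sphere (0 : E) 1) m : E))
          ∂Measure.pi (fun _ : Λ => uniformSphere (volume : Measure E))) *
        (esAction κ S₀ U (fun m => (ω m : E)) - S₀)
          ∂Measure.pi (fun _ : Λ => uniformSphere (volume : Measure E)) := by
    have hfun : (fun ω : Λ → sphere (0 : E) 1 => St k (fun m => (ω m : E)) *
        (esAction κ S₀ U (fun m => (ω m : E)) - S₀)) =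
        fun ω => (St k (fun m => (ω m : E)) -
          ∫ ω', St k (fun m => ((ω' : Λ → sphere (0 : E) 1) m : E))
            ∂Measure.pi (fun _ : Λ => uniformSphere (volume : Measure E))) *
          (esAction κ S₀ U (fun m => (ω m : E)) - S₀) +
          (∫ ω', St k (fun m => ((ω' : Λ → sphere (0 : E) 1) m : E))
            ∂Measure.pi (fun _ : Λ => uniformSphere (volume : Measure E))) *
            (esAction κ S₀ U (fun m => (ω m : E)) - S₀) := by
      funext ω; ring
    rw [hfun, integral_add hiP hiS, integral_const_mul, hmean, mul_zero, add_zero]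
  have hcs := sq_integral_mul_le (Λ := Λ) (E := E) hc1 hc2
  have hV1 := variance_luscher_series_esAction_le h2 hU0 hUadj κ S₀ hυ hΔ hSt h0 hs k
  have hV2 := variance_esAction_le h2 hU0 hUadj κ S₀ hυ hΔ
  have hnn : 0 ≤ ∫ ω, (esAction κ S₀ U (fun m => ((ω : Λ → sphere (0 : E) 1) m : E)) - S₀) ^ 2
      ∂Measure.pi (fun _ : Λ => uniformSphere (volume : Measure E)) :=
    integral_nonneg fun ω => sq_nonneg _
  have hnn' : 0 ≤ ∫ ω, (St k (fun m => ((ω : Λ → sphere (0 : E) 1) m : E)) -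
      ∫ ω', St k (fun m => ((ω' : Λ → sphere (0 : E) 1) m : E))
        ∂Measure.pi (fun _ : Λ => uniformSphere (volume : Measure E))) ^ 2
          ∂Measure.pi (fun _ : Λ => uniformSphere (volume : Measure E)) :=
    integral_nonneg fun ω => sq_nonneg _
  have hB1 := hnn'.trans hV1
  have hd : 0 ≤ 4 * ((Module.finrank ℝ E : ℝ) - 1) ^ 2 := by positivity
  rw [luscher_constant_succ_eq hU0 hUadj κ S₀ hSt hs k, hcentre, mul_pow]
  have e4 : (2 * ((Module.finrank ℝ E : ℝ) - 1)) ^ 2 = 4 * ((Module.finrank ℝ E : ℝ) - 1) ^ 2 := by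
    ring
  rw [e4, mul_assoc (4 * ((Module.finrank ℝ E : ℝ) - 1) ^ 2)]
  exact mul_le_mul_of_nonneg_left (hcs.trans (mul_le_mul hV1 hV2 hnn hB1)) hd

end Extensive

end Summit.Ventures.LatticeQCDFlow.Exactness

end
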